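import Literature.NumberTheory.Automorphic.IdeleClassBaseChangeInjective
import Literature.NumberTheory.Automorphic.IdeleClassGroupUnitMaps
import HarnessLib

/-!
# Base change of idèle classes and the infinite idèles: `ι[x] ∈ [L_∞ˣ]` forces `[x] ∈ [K_∞ˣ]`

Topic `NumberTheory/Automorphic`; namespace `Literature.NumberTheory.Automorphic`. One definition
(`infiniteIdeleBaseChange`, the base change `K_∞ˣ → L_∞ˣ` on units) and theorems; everything is proved, no named
fact, no instance.

For a finite extension of number fields `L/K`, `ι = classBaseChange K L : C_K → C_L`, and the classes
`[·] : K_∞ˣ → C_K`, `[·] : L_∞ˣ → C_L` of the infinite idèles (the tree's `infUnitsToClass`,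
`IdeleClassGroupUnitMaps.lean`):

* `infiniteIdeleBaseChange K L : K_∞ˣ →* L_∞ˣ`, `y ↦ y_L` (units of the tree's `InfiniteAdeleRing.baseChange`);
  `ideleBaseChange_infiniteIdeles` — `((y, 1))_L = (y_L, 1)`; `classBaseChange_infUnitsToClass` — `ι[y] = [y_L]`.
* **`exists_infiniteIdeles_of_classBaseChange_eq`** (`L/K` Galois): if `ι c = [u]` for an infinite idèle `u` of
  `L`, then `c = [y]` for an infinite idèle `y` of `K` with `y_L = u`. Proof: `c = [x]`, `x_L = (u, 1)·(ℓ)` with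
  `ℓ ∈ Lˣ`; for `σ ∈ Gal(L/K)` the finite part of `(σ ℓ) = σ • (ℓ)` equals that of `(ℓ)` (`σ` fixes `x_L`, and
  `(u, 1)` has trivial finite part), so `σ ℓ = ℓ` (the diagonal map `L → 𝔸_{L,f}` is injective) and `ℓ = k ∈ Kˣ`
  (`L/K` Galois); then `z = x·(k)⁻¹` has `z_L = (u, 1)`, hence trivial finite part
  (`FiniteAdeleRing.baseChange_injective`), i.e. `z = (y, 1)` with `y_L = u`. This is the identity
  `Lˣ ∩ 𝔸ˣ_K · L_∞ˣ = Kˣ · (K_∞ˣ ∩ …)` behind "the two prescriptions agree on `L_∞ˣ ∩ 𝔸ˣ_{L₀} = L_{0,∞}ˣ` and are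
  trivial on `Lˣ ∩ 𝔸ˣ_{L₀} L_∞ˣ = L₀ˣ`" in existence arguments for Hecke characters with prescribed restriction to
  `C_{L₀}` (e.g. PerL v5 §3.2, tex ll. 307–308).
* **`classBaseChange_compat_of_arch`** (`L/K` Galois): for homomorphisms `χ : C_K →* M`, `ψ : L_∞ˣ →* M`, the
  compatibility "`ι a = [u] ⇒ χ a = ψ u`" (hypothesis `hcompat` of
  `IdeleClassGroup.exists_ideleClassChar_of_isProperMap` for `f = ι`) FOLLOWS from its archimedean instance
  "`χ[y] = ψ(y_L)` for all `y ∈ K_∞ˣ`".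

Provenance: tree-vocabulary form of the `pub-hodgecm` package file `HodgeCM/Literature/ClassBaseChangeCompat.lean`
(CITED-FACT seat gen 5: `infBaseChange`, `ideleBaseChange_infUnitsToIdele`, `exists_infUnits_of_classBaseChange_eq`,
`hcompat_of_arch`), over the tree's `classBaseChange` / `infUnitsToClass` / Galois action on `𝔸_L`
(`GaloisActionAdeleRing.lean`, `ClassFieldCharacter.lean`).

## References

* J. W. S. Cassels, A. Fröhlich (eds.), *Algebraic Number Theory* (1967), Ch. VII (Tate) §1.1 (Galois action on
  adèles and idèles, `𝔸_K = 𝔸_L^{Gal}`). [CasselsFrohlichANT1967]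
* A. Weil, *Basic Number Theory* (1967), Ch. IV §1 (`k_𝔸 ⊂ k'_𝔸`), Ch. VII §3. [WeilBNT1967]
-/

noncomputable section

open NumberField IsDedekindDomain

namespace Literature.NumberTheory.Automorphic

open GaloisRepresentations

section General

variable (K L : Type) [Field K] [Field L] [Algebra K L] [NumberField K] [NumberField L]

/-! ## Base change of infinite idèles -/

/-- **Base change of infinite idèles** `K_∞ˣ →* L_∞ˣ`, `y ↦ y_L = (y_{w|_K})_w` (units of the tree's
`InfiniteAdeleRing.baseChange`). [folklore] -/
def infiniteIdeleBaseChange : (InfiniteAdeleRing K)ˣ →* (InfiniteAdeleRing L)ˣ :=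
  Units.map (InfiniteAdeleRing.baseChange K L).toMonoidHom

omit [NumberField K] [NumberField L] in
/-- Underlying infinite adèle of `y_L` (definitional). [folklore] -/
@[simp]
theorem coe_infiniteIdeleBaseChange (y : (InfiniteAdeleRing K)ˣ) :
    ((infiniteIdeleBaseChange K L y : (InfiniteAdeleRing L)ˣ) : InfiniteAdeleRing L) =
      InfiniteAdeleRing.baseChange K L (y : InfiniteAdeleRing K) := rfl

omit [NumberField K] [NumberField L] in
/-- Components of `y_L`: `(y_L)_w = (y_{w|_K})` in `L_w`. [folklore] -/
theorem infiniteIdeleBaseChange_apply (y : (InfiniteAdeleRing K)ˣ) (w : InfinitePlace L) :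
    ((infiniteIdeleBaseChange K L y : (InfiniteAdeleRing L)ˣ) : InfiniteAdeleRing L) w =
      infiniteCompletionOfComap K L w ((y : InfiniteAdeleRing K) (w.comap (algebraMap K L))) := rfl

/-- **`((y, 1))_L = (y_L, 1)`**: base change commutes with the inclusion of the infinite idèles. [folklore] -/
theorem ideleBaseChange_infiniteIdeles (y : (InfiniteAdeleRing K)ˣ) :
    AdeleRing.ideleBaseChange K L (infiniteIdeles K y) = infiniteIdeles L (infiniteIdeleBaseChange K L y) := by
  refine Units.ext (Prod.ext rfl ?_)
  change FiniteAdeleRing.baseChange (𝓞 K) K L (𝓞 L) 1 = 1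
  exact map_one _

/-- **`ι[y] = [y_L]`** on idèle classes. [folklore] -/
theorem classBaseChange_infUnitsToClass (y : (InfiniteAdeleRing K)ˣ) :
    classBaseChange K L (infUnitsToClass K y) = infUnitsToClass L (infiniteIdeleBaseChange K L y) := by
  rw [infUnitsToClass_apply, infUnitsToClass_apply, classBaseChange_mk, ideleBaseChange_infiniteIdeles]

/-- An idèle with trivial finite part is an infinite idèle: `x = (x_∞, 1)`. [folklore] -/
theorem eq_infiniteIdeles_of_snd_eq_one {x : ideleGroup K} (hx : (x : AdeleRing (𝓞 K) K).2 = 1) :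
    ∃ y : (InfiniteAdeleRing K)ˣ, x = infiniteIdeles K y := by
  refine ⟨Units.map (RingHom.fst (InfiniteAdeleRing K) (FiniteAdeleRing (𝓞 K) K)).toMonoidHom x,
    Units.ext (Prod.ext rfl ?_)⟩
  rw [hx]
  rfl

omit [NumberField K] [Algebra K L] in
/-- The diagonal map `L → 𝔸_{L,f}` (finite part of `L → 𝔸_L`) is injective. [folklore] -/
theorem algebraMap_adeleRing_snd_injective {ℓ ℓ' : L}
    (h : (algebraMap L (AdeleRing (𝓞 L) L) ℓ).2 = (algebraMap L (AdeleRing (𝓞 L) L) ℓ').2) : ℓ = ℓ' := by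
  obtain ⟨I, hI⟩ := Ideal.exists_maximal (𝓞 L)
  let w : HeightOneSpectrum (𝓞 L) :=
    ⟨I, hI.isPrime, Ring.ne_bot_of_isMaximal_of_not_isField hI (RingOfIntegers.not_isField L)⟩
  have hw := congrArg (fun z : FiniteAdeleRing (𝓞 L) L => z w) h
  change algebraMap L (FiniteAdeleRing (𝓞 L) L) ℓ w = algebraMap L (FiniteAdeleRing (𝓞 L) L) ℓ' w at hw
  rw [FiniteAdeleRing.algebraMap_apply, FiniteAdeleRing.algebraMap_apply] at hw
  exact (algebraMap L (w.adicCompletion L)).injective hw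

end General

/-! ## `ι c ∈ [L_∞ˣ] ⇒ c ∈ [K_∞ˣ]` for `L/K` Galois -/

section Galois

variable (K L : Type) [Field K] [Field L] [Algebra K L] [NumberField K] [NumberField L] [IsGalois K L]

/-- An element of `L` whose principal adèle has `Gal(L/K)`-invariant finite part lies in `K`. [folklore] -/
theorem exists_algebraMap_eq_of_forall_smul_snd_eq {ℓ : L}
    (h : ∀ σ : L ≃ₐ[K] L, (σ • algebraMap L (AdeleRing (𝓞 L) L) ℓ).2 = (algebraMap L (AdeleRing (𝓞 L) L) ℓ).2) :
    ∃ k : K, algebraMap K L k = ℓ := by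
  have hfix : ∀ σ : L ≃ₐ[K] L, σ ℓ = ℓ := fun σ =>
    algebraMap_adeleRing_snd_injective L (by rw [← AdeleRing.smul_algebraMap K σ ℓ]; exact h σ)
  have hmem : ℓ ∈ (⊥ : IntermediateField K L) := by
    rw [← IsGalois.fixedField_top]
    exact fun σ => hfix σ
  exact IntermediateField.mem_bot.1 hmem

/-- **`ι[x] = [(u, 1)] ⇒ [x] = [(y, 1)]` with `y_L = u`** (`L/K` Galois). [cite: CasselsFrohlichANT1967, Ch. VII §1.1] -/
theorem exists_infiniteIdeles_of_classBaseChange_eq (c : IdeleClassGroup K) (u : (InfiniteAdeleRing L)ˣ)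
    (h : classBaseChange K L c = infUnitsToClass L u) :
    ∃ y : (InfiniteAdeleRing K)ˣ, c = infUnitsToClass K y ∧ infiniteIdeleBaseChange K L y = u := by
  induction c using QuotientGroup.induction_on with
  | H x =>
    rw [classBaseChange_mk, infUnitsToClass_apply, QuotientGroup.eq] at h
    -- `x_L⁻¹ (u, 1) = (ℓ)`, `ℓ ∈ Lˣ`
    obtain ⟨ℓ, hℓ⟩ := h
    -- the finite part of `(ℓ)` is `Gal(L/K)`-invariant
    have hsnd : ((Units.map (algebraMap L (AdeleRing (𝓞 L) L) : L →* AdeleRing (𝓞 L) L) ℓ : ideleGroup L) :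
        AdeleRing (𝓞 L) L).2 = (((AdeleRing.ideleBaseChange K L x)⁻¹ : ideleGroup L) : AdeleRing (𝓞 L) L).2 := by
      rw [hℓ, Units.val_mul]
      change _ * ((infiniteIdeles L u : ideleGroup L) : AdeleRing (𝓞 L) L).2 = _
      rw [show ((infiniteIdeles L u : ideleGroup L) : AdeleRing (𝓞 L) L).2 = 1 from rfl, mul_one]
    have hinv : ∀ σ : L ≃ₐ[K] L,
        (σ • algebraMap L (AdeleRing (𝓞 L) L) (ℓ : L)).2 = (algebraMap L (AdeleRing (𝓞 L) L) (ℓ : L)).2 := by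
      intro σ
      have h0 : (algebraMap L (AdeleRing (𝓞 L) L) (ℓ : L)).2 =
          (((AdeleRing.ideleBaseChange K L x)⁻¹ : ideleGroup L) : AdeleRing (𝓞 L) L).2 := hsnd
      rw [AdeleRing.smul_snd, h0]
      have h2 : σ • (AdeleRing.ideleBaseChange K L x)⁻¹ = (AdeleRing.ideleBaseChange K L x)⁻¹ := by
        rw [smul_inv', AdeleRing.smul_ideleBaseChange]
      have h3 := congrArg (fun z : ideleGroup L => ((z : AdeleRing (𝓞 L) L)).2) h2
      simpa only [AdeleRing.coe_smul_units, AdeleRing.smul_snd] using h3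
    -- hence `ℓ = k ∈ K`
    obtain ⟨k, hk⟩ := exists_algebraMap_eq_of_forall_smul_snd_eq K L hinv
    have hk0 : k ≠ 0 := by
      rintro rfl
      rw [map_zero] at hk
      exact ℓ.ne_zero hk.symm
    -- `z = x · (k)`, `z_L = (u, 1)`
    set kK : ideleGroup K := Units.map (algebraMap K (AdeleRing (𝓞 K) K) : K →* AdeleRing (𝓞 K) K)
      (Units.mk0 k hk0) with hkK
    have hkL : AdeleRing.ideleBaseChange K L kK =
        Units.map (algebraMap L (AdeleRing (𝓞 L) L) : L →* AdeleRing (𝓞 L) L) ℓ := by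
      refine Units.ext ?_
      rw [AdeleRing.coe_ideleBaseChange, hkK, Units.coe_map, MonoidHom.coe_coe, Units.val_mk0,
        AdeleRing.baseChange_algebraMap, hk]
      rfl
    have hz : AdeleRing.ideleBaseChange K L (x * kK) = infiniteIdeles L u := by
      rw [map_mul, hkL, hℓ, mul_inv_cancel_left]
    -- so `x · (k)` has trivial finite part: it is `(y, 1)`
    have hsnd1 : (((x * kK : ideleGroup K)) : AdeleRing (𝓞 K) K).2 = 1 := by
      apply FiniteAdeleRing.baseChange_injective (𝓞 K) K L (𝓞 L)
      rw [map_one, ← AdeleRing.baseChange_snd, ← AdeleRing.coe_ideleBaseChange, hz]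
      rfl
    obtain ⟨y, hy⟩ := eq_infiniteIdeles_of_snd_eq_one K hsnd1
    refine ⟨y, ?_, ?_⟩
    · -- `[x] = [x (k)] = [(y, 1)]`
      rw [infUnitsToClass_apply, ← hy]
      refine QuotientGroup.eq.2 ?_
      rw [inv_mul_cancel_left]
      exact ⟨Units.mk0 k hk0, rfl⟩
    · -- `y_L = u`
      have h4 : infiniteIdeles L (infiniteIdeleBaseChange K L y) = infiniteIdeles L u := by
        rw [← ideleBaseChange_infiniteIdeles, ← hy, hz]
      exact Units.ext (congrArg (fun z : ideleGroup L => (z : AdeleRing (𝓞 L) L).1) h4)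

/-- **The compatibility hypothesis from its archimedean instance** (`L/K` Galois). For maps `χ` on `C_K` and `ψ` on
`L_∞ˣ` (e.g. a character `χ_A` of `A = C_K` and an ∞-type character `infinityTypeChar L e`, as in the hypothesis
`hcompat` of `IdeleClassGroup.exists_ideleClassChar_of_isProperMap` with `f = classBaseChange K L`): if
`χ[y] = ψ(y_L)` for every infinite idèle `y` of `K`, then `ι a = [u] ⇒ χ a = ψ u` for all `a ∈ C_K`, `u ∈ L_∞ˣ`.
[folklore] -/
theorem classBaseChange_compat_of_arch {M : Sort*} (χ : IdeleClassGroup K → M) (ψ : (InfiniteAdeleRing L)ˣ → M)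
    (harch : ∀ y : (InfiniteAdeleRing K)ˣ, χ (infUnitsToClass K y) = ψ (infiniteIdeleBaseChange K L y))
    (a : IdeleClassGroup K) (u : (InfiniteAdeleRing L)ˣ) (h : classBaseChange K L a = infUnitsToClass L u) :
    χ a = ψ u := by
  obtain ⟨y, rfl, rfl⟩ := exists_infiniteIdeles_of_classBaseChange_eq K L a u h
  exact harch y

end Galois

end Literature.NumberTheory.Automorphic

end
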